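import Literature.MathematicalPhysics.QuantumFieldTheory.Chatterjee2019LargeN.LoopOperations
import HarnessLib

/-!
# Chatterjee 2019, Theorem 9.1 from Theorem 8.1: the master loop equation in the 't Hooft limit

S. Chatterjee, *Rigorous solution of strongly coupled `SO(N)` lattice gauge theory in the large `N` limit*,
Comm. Math. Phys. **366** (2019) 203–268 (arXiv:1502.07719), **§9, Theorem 9.1** and its printed proof («The proof
is a direct application of Theorem 8.1 and the fact that `|W_l| ≤ N` for any loop `l`. Simply divide both sides of
the finite `N` master loop equation … by `N^{n+1}`. It is an easy consequence of the bound `|W_l| ≤ N` that the merger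
and twisting terms vanish as `N` goes to infinity. The left-hand side …, upon dividing by `N^{n+1}`, tends to
`m φ_β(s)` as `N` tends to infinity along the subsequence. The splitting and deformation terms tend to the respective
terms displayed above.»).

THEOREMS ONLY (net debt 0): `thooftMasterLoopEquation_of_unsymmetrized : UnsymmetrizedMasterLoopEquation d →
THooftMasterLoopEquation d` — the tree's named fact for Theorem 9.1 (`MasterLoopEquation`) follows from the tree's
named fact for Theorem 8.1 (the finite-`N` equation at a marked edge).  Ingredients, all proved here or in the sibling
modules: `φ_{Λ,N,β}` ignores null components (`phi_prune`, `W_∅ = N`); the four terms of Theorem 8.1 are linear in the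
evaluation (`twistTermAt_mul`, …) and depend only on its values on the produced sequences (`…_congr`); those sequences
are genuine loop sequences after deleting null loops (`LoopOperations`); along an exhaustion `Λ_N ↑ ℤ^d` the
hypothesis «all vertices at distance `≤ 1` from `s` are in `Λ_N`» holds eventually
(`IsExhaustion.eventually_vertices_mem`).  The merger and twisting terms are `1/N²` resp. `1/N` times CONVERGENT
sequences (by the convergence hypothesis of Theorem 9.1 applied to the genuine produced sequences), so the bound
`|W_l| ≤ N` of the printed proof is not needed.

## WHAT THIS IS NOT
Theorem 8.1 itself (`UnsymmetrizedMasterLoopEquation`, Stein's method / integration by parts on `SO(N)`, §§5–8)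
remains a named fact; so do Theorems 9.2 and 9.9.
-/

noncomputable section

open Literature.Probability.LatticeModels Literature.MathematicalPhysics.QuantumLattice

namespace Literature.MathematicalPhysics.QuantumFieldTheory.Chatterjee2019LargeN

variable {d : ℕ}

section THooftFromFiniteN

open Filter Topology MeasureTheory

/-! ### `φ_{Λ,N,β}` ignores null components (`W_∅ = N`) -/

/-- `W_{l₁} ⋯ W_{lₙ} = N^{#null components} · ∏_{lᵢ ≠ ∅} W_{lᵢ}` pointwise (`W_∅ = N`).
[cite: Chatterjee2019LargeN, §3 («By definition, W_∅ = N»)] -/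
theorem wilsonProd_eq_pow_mul_prune (N : ℕ) (s : LoopSeq d) (U : ZdGaugeConfig d (SO N)) :
    wilsonProd N s U = (N : ℝ) ^ (s.length - (LoopSeq.prune s).length) * wilsonProd N (LoopSeq.prune s) U := by
  induction s with
  | nil => simp [wilsonProd, LoopSeq.prune]
  | cons l s ih =>
    have hle : (LoopSeq.prune s).length ≤ s.length := List.length_filter_le _ _
    by_cases hl : l = []
    · subst hl
      have hp : LoopSeq.prune (([] : Word d) :: s) = LoopSeq.prune s := by simp [LoopSeq.prune]
      rw [hp, List.length_cons, show s.length + 1 - (LoopSeq.prune s).length =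
        (s.length - (LoopSeq.prune s).length) + 1 by omega, pow_succ]
      simp only [wilsonProd, List.map_cons, List.prod_cons, wilsonLoopVar_nil] at ih ⊢
      rw [ih]; ring
    · have hp : LoopSeq.prune (l :: s) = l :: LoopSeq.prune s := by simp [LoopSeq.prune, hl]
      rw [hp, List.length_cons, List.length_cons, show s.length + 1 - ((LoopSeq.prune s).length + 1) =
        s.length - (LoopSeq.prune s).length by omega]
      simp only [wilsonProd, List.map_cons, List.prod_cons] at ih ⊢
      rw [ih]; ring

/-- `φ_{Λ,N,β}(s) = φ_{Λ,N,β}` of the minimal representation of `s` (null loops deleted), for `N ≥ 1`.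
[cite: Chatterjee2019LargeN, §3 Thm. 3.6 (φ(s) on minimal representations; W_∅ = N)] -/
theorem phi_prune (N : ℕ) (hN : N ≠ 0) (β : ℝ) (Λ : Finset (Literature.Probability.LatticeModels.Site d))
    (s : LoopSeq d) : phi N β Λ s = phi N β Λ (LoopSeq.prune s) := by
  have hle : (LoopSeq.prune s).length ≤ s.length := List.length_filter_le _ _
  have hN' : (N : ℝ) ≠ 0 := by exact_mod_cast hN
  set k := s.length - (LoopSeq.prune s).length with hk
  have hlen : s.length = k + (LoopSeq.prune s).length := by omega
  unfold phi soExpect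
  have hint : ∫ U, wilsonProd N s U ∂soMeasure N β Λ =
      (N : ℝ) ^ k * ∫ U, wilsonProd N (LoopSeq.prune s) U ∂soMeasure N β Λ := by
    rw [← integral_const_mul]
    congr 1
    funext U
    rw [wilsonProd_eq_pow_mul_prune N s U]
  rw [hint, hlen, pow_add]
  field_simp

/-- `⟨W_{l₁} ⋯ W_{lₙ}⟩ = φ(s) · Nⁿ`. [cite: Chatterjee2019LargeN, §3 Thm. 3.6 (definition of φ(s))] -/
theorem soExpect_wilsonProd_eq (N : ℕ) (hN : N ≠ 0) (β : ℝ) (Λ : Finset (Literature.Probability.LatticeModels.Site d))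
    (s : LoopSeq d) : soExpect N β Λ (wilsonProd N s) = phi N β Λ s * (N : ℝ) ^ s.length := by
  have hN' : (N : ℝ) ≠ 0 := by exact_mod_cast hN
  rw [phi, div_mul_cancel₀ _ (pow_ne_zero _ hN')]

/-! ### The four terms of Theorem 8.1 are linear in the evaluation and depend only on its relevant values -/

/-- The twisting term is linear in the evaluation `F`. [cite: Chatterjee2019LargeN, Theorem 8.1 (twisting term)] -/
theorem twistTermAt_mul (c : ℝ) (F : LoopSeq d → ℝ) (l : Word d) (rest : LoopSeq d) (e : DEdge d) :
    twistTermAt (fun s => c * F s) l rest e = c * twistTermAt F l rest e := by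
  simp [twistTermAt, Finset.mul_sum, mul_sub]

/-- The splitting term is linear in the evaluation `F`. [cite: Chatterjee2019LargeN, Theorem 8.1 (splitting term)] -/
theorem splitTermAt_mul (c : ℝ) (F : LoopSeq d → ℝ) (l : Word d) (rest : LoopSeq d) (e : DEdge d) :
    splitTermAt (fun s => c * F s) l rest e = c * splitTermAt F l rest e := by
  simp [splitTermAt, Finset.mul_sum, mul_sub]

/-- The merger term is linear in the evaluation `F`. [cite: Chatterjee2019LargeN, Theorem 8.1 (merger term)] -/
theorem mergeTermAt_mul (c : ℝ) (F : LoopSeq d → ℝ) (l : Word d) (rest : LoopSeq d) (e : DEdge d) :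
    mergeTermAt (fun s => c * F s) l rest e = c * mergeTermAt F l rest e := by
  simp [mergeTermAt, Finset.mul_sum, mul_sub]

/-- The deformation term is linear in the evaluation `F`. [cite: Chatterjee2019LargeN, Theorem 8.1 (deformation term)] -/
theorem deformTermAt_mul (c : ℝ) (F : LoopSeq d → ℝ) (l : Word d) (rest : LoopSeq d) (e : DEdge d) :
    deformTermAt (fun s => c * F s) l rest e = c * deformTermAt F l rest e := by
  simp [deformTermAt, Finset.mul_sum, mul_sub]

/-- The twisting term depends only on the values of `F` on the twisted sequences. [cite: Chatterjee2019LargeN, Theorem 8.1 (twisting term)] -/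
theorem twistTermAt_congr {F G : LoopSeq d → ℝ} {l : Word d} {rest : LoopSeq d} {e : DEdge d}
    (h₁ : ∀ xy ∈ Word.samePairs l e, F (Word.negTwist l xy.1 xy.2 :: rest) = G (Word.negTwist l xy.1 xy.2 :: rest))
    (h₂ : ∀ xy ∈ Word.invPairs l e, F (Word.posTwist l xy.1 xy.2 :: rest) = G (Word.posTwist l xy.1 xy.2 :: rest)) :
    twistTermAt F l rest e = twistTermAt G l rest e := by
  rw [twistTermAt, twistTermAt, Finset.sum_congr rfl h₁, Finset.sum_congr rfl h₂]

/-- The splitting term depends only on the values of `F` on the split sequences. [cite: Chatterjee2019LargeN, Theorem 8.1 (splitting term)] -/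
theorem splitTermAt_congr {F G : LoopSeq d → ℝ} {l : Word d} {rest : LoopSeq d} {e : DEdge d}
    (h₁ : ∀ xy ∈ Word.invPairs l e, F (Word.negSplit₁ l xy.1 xy.2 :: Word.negSplit₂ l xy.1 xy.2 :: rest) =
      G (Word.negSplit₁ l xy.1 xy.2 :: Word.negSplit₂ l xy.1 xy.2 :: rest))
    (h₂ : ∀ xy ∈ Word.samePairs l e, F (Word.posSplit₁ l xy.1 xy.2 :: Word.posSplit₂ l xy.1 xy.2 :: rest) =
      G (Word.posSplit₁ l xy.1 xy.2 :: Word.posSplit₂ l xy.1 xy.2 :: rest)) :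
    splitTermAt F l rest e = splitTermAt G l rest e := by
  rw [splitTermAt, splitTermAt, Finset.sum_congr rfl h₁, Finset.sum_congr rfl h₂]

/-- The deformation term depends only on the values of `F` on the deformed sequences. [cite: Chatterjee2019LargeN, Theorem 8.1 (deformation term)] -/
theorem deformTermAt_congr {F G : LoopSeq d → ℝ} {l : Word d} {rest : LoopSeq d} {e : DEdge d}
    (h₁ : ∀ p ∈ plaquettesAt e, ∀ x ∈ Word.locs l e, F (Word.negDeform l x p :: rest) = G (Word.negDeform l x p :: rest))
    (h₂ : ∀ p ∈ plaquettesAt e, ∀ x ∈ Word.locs l e, F (Word.posDeform l x p :: rest) = G (Word.posDeform l x p :: rest)) :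
    deformTermAt F l rest e = deformTermAt G l rest e := by
  rw [deformTermAt, deformTermAt, Finset.sum_congr rfl fun p hp => Finset.sum_congr rfl (h₁ p hp),
    Finset.sum_congr rfl fun p hp => Finset.sum_congr rfl (h₂ p hp)]

/-- The merger term depends only on the values of `F` on the merged sequences. [cite: Chatterjee2019LargeN, Theorem 8.1 (merger term)] -/
theorem mergeTermAt_congr {F G : LoopSeq d → ℝ} {l : Word d} {rest : LoopSeq d} {e : DEdge d}
    (h₁ : ∀ (j : Fin rest.length), ∀ x ∈ Word.locs l e, ∀ y ∈ Word.locs (rest.get j) e,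
      F (Word.negMerge l x (rest.get j) y :: rest.eraseIdx j) = G (Word.negMerge l x (rest.get j) y :: rest.eraseIdx j))
    (h₂ : ∀ (j : Fin rest.length), ∀ x ∈ Word.locs l e, ∀ y ∈ Word.locs (rest.get j) e,
      F (Word.posMerge l x (rest.get j) y :: rest.eraseIdx j) = G (Word.posMerge l x (rest.get j) y :: rest.eraseIdx j)) :
    mergeTermAt F l rest e = mergeTermAt G l rest e := by
  rw [mergeTermAt, mergeTermAt,
    Finset.sum_congr rfl fun j _ => Finset.sum_congr rfl fun x hx => Finset.sum_congr rfl (h₁ j x hx),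
    Finset.sum_congr rfl fun j _ => Finset.sum_congr rfl fun x hx => Finset.sum_congr rfl (h₂ j x hx)]

/-! ### The loop sequences produced at the marked edge are genuine after deleting null loops -/

namespace Word

/-- Pairs in `A₁ × A₁ ∪ B₁ × B₁` (`x ≠ y`) carry the same letter. [cite: Chatterjee2019LargeN, Theorem 8.1 (the sets A₁, B₁)] -/
theorem get_eq_of_mem_samePairs {l : Word d} {e : DEdge d} {xy : Fin l.length × Fin l.length}
    (h : xy ∈ samePairs l e) : xy.1 ≠ xy.2 ∧ l.get xy.2 = l.get xy.1 := by
  rw [samePairs, Finset.mem_filter] at h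
  exact ⟨h.2.1, h.2.2.1.symm⟩

/-- Pairs in `A₁ × B₁ ∪ B₁ × A₁` carry inverse letters. [cite: Chatterjee2019LargeN, Theorem 8.1 (the sets A₁, B₁)] -/
theorem get_eq_of_mem_invPairs {l : Word d} {e : DEdge d} {xy : Fin l.length × Fin l.length}
    (h : xy ∈ invPairs l e) : l.get xy.2 = DEdge.inv (l.get xy.1) := by
  rw [invPairs, Finset.mem_filter] at h
  rcases h.2 with ⟨h1, h2⟩ | ⟨h1, h2⟩
  · rw [h1, h2]
  · rw [h1, h2, DEdge.inv_inv]

/-- `𝒫⁺(e_x) = 𝒫⁺(e)` for `x ∈ C₁` (the undirected edge is the same). [cite: Chatterjee2019LargeN, Theorem 8.1 (C₁ = A₁ ∪ B₁), §2.2 (𝒫⁺(e))] -/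
theorem plaquettesAt_eq_of_mem_locs {l : Word d} {e : DEdge d} {x : Fin l.length} (h : x ∈ locs l e) :
    plaquettesAt (l.get x) = plaquettesAt e := by
  rw [locs, Finset.mem_filter] at h
  rcases h.2 with h | h
  · rw [h]
  · rw [h]; rfl

/-- For `x ∈ C₁` the letter at `x` carries the undirected edge of `e`. [cite: Chatterjee2019LargeN, Theorem 8.1 (C₁ = A₁ ∪ B₁)] -/
theorem fst_get_eq_of_mem_locs {l : Word d} {e : DEdge d} {x : Fin l.length} (h : x ∈ locs l e) :
    (l.get x).1 = e.1 := by
  rw [locs, Finset.mem_filter] at h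
  rcases h.2 with h | h
  · rw [h]
  · rw [h]; rfl

end Word

/-- Members of `prune (a :: rest)`, `prune (a :: b :: rest)` etc. [folklore] -/
private theorem isLoopSeq_prune_of {L rest : LoopSeq d} (hrest : IsLoopSeq rest) (hL : ∀ w ∈ L, IsLoop w) :
    IsLoopSeq (LoopSeq.prune (L ++ rest)) :=
  LoopSeq.isLoopSeq_prune fun w hw => by
    rcases List.mem_append.mp hw with h | h
    · exact hL w h
    · exact (hrest w h).1

/-! ### Eventually the growing region contains the unit neighbourhood of the loop sequence -/

/-- The unit Euclidean ball of `ℤ^d` around a point is finite. [folklore] -/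
private theorem finite_ball (c : Literature.Probability.LatticeModels.Site d) :
    {v : Literature.Probability.LatticeModels.Site d | latticeNorm (v - c) ≤ 1}.Finite := by
  refine (Set.Finite.pi fun i : Fin d => Set.finite_Icc (c i - 1) (c i + 1)).subset fun v hv => ?_
  simp only [Set.mem_setOf_eq] at hv
  simp only [Set.mem_pi, Set.mem_univ, Set.mem_Icc, forall_true_left]
  intro i
  have h1 : |((v - c) i : ℝ)| ≤ 1 := by
    have := PiLp.norm_apply_le (WithLp.toLp 2 fun j => ((v - c) j : ℝ) : EuclideanSpace ℝ (Fin d)) i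
    rw [Real.norm_eq_abs] at this
    exact this.trans hv
  have h2 : |v i - c i| ≤ (1 : ℤ) := by
    have : ((v - c) i : ℝ) = ((v i - c i : ℤ) : ℝ) := by simp
    rw [this] at h1
    exact_mod_cast h1
  rw [abs_le] at h2
  constructor <;> omega

/-- For an exhaustion `Λ_N ↑ ℤ^d`, eventually every lattice point within distance `1` of the loop sequence lies in
`Λ_N` (the hypothesis of Theorems 3.6/8.1). [cite: Chatterjee2019LargeN, Theorem 8.1 (hypothesis on Λ), §9 (Λ_N increasing to ℤ^d)] -/
theorem IsExhaustion.eventually_vertices_mem {Λ : ℕ → Finset (Literature.Probability.LatticeModels.Site d)}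
    (hΛ : IsExhaustion Λ) (s : LoopSeq d) :
    ∀ᶠ N in atTop, ∀ l ∈ s, ∀ a ∈ l, ∀ v : Literature.Probability.LatticeModels.Site d,
      latticeNorm (v - DEdge.src a) ≤ 1 ∨ latticeNorm (v - DEdge.tgt a) ≤ 1 → v ∈ Λ N := by
  set V : Set (Literature.Probability.LatticeModels.Site d) :=
    ⋃ l ∈ {l | l ∈ s}, ⋃ a ∈ {a : DEdge d | a ∈ l},
      ({v | latticeNorm (v - DEdge.src a) ≤ 1} ∪ {v | latticeNorm (v - DEdge.tgt a) ≤ 1}) with hV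
  have hfin : V.Finite := by
    refine Set.Finite.biUnion (List.finite_toSet s) fun l _ => Set.Finite.biUnion (List.finite_toSet l) fun a _ => ?_
    exact (finite_ball _).union (finite_ball _)
  have hev : ∀ᶠ N in atTop, ∀ v ∈ V, v ∈ Λ N := by
    rw [hfin.eventually_all]
    intro v _
    obtain ⟨n, hn⟩ := hΛ.2 v
    exact eventually_atTop.mpr ⟨n, fun N hN => hΛ.1 hN hn⟩
  filter_upwards [hev] with N hN l hl a ha v hv
  refine hN v ?_
  rw [hV]
  simp only [Set.mem_iUnion, Set.mem_setOf_eq, Set.mem_union, exists_prop]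
  exact ⟨l, hl, a, ha, hv⟩

/-! ### Theorem 9.1 from Theorem 8.1 -/

/-- **Theorem 9.1 (master loop equation in the 't Hooft limit), PROVED from Theorem 8.1** (the finite-`N` equation at
a marked edge, the named fact `UnsymmetrizedMasterLoopEquation`).  The printed proof: «The proof is a direct application
of Theorem 8.1 and the fact that `|W_l| ≤ N` for any loop `l`. Simply divide both sides of the finite `N` master loop
equation … by `N^{n+1}`. It is an easy consequence of the bound `|W_l| ≤ N` that the merger and twisting terms vanish
as `N` goes to infinity. The left-hand side …, upon dividing by `N^{n+1}`, tends to `m φ_β(s)` … The splitting and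
deformation terms tend to the respective terms displayed above.»  Here the merger and twisting terms are `1/N²` resp.
`1/N` times CONVERGENT sequences (the `φ_{Λ_N,N,β}` of the — genuine, by `LoopOperations` — resulting loop sequences
converge by hypothesis), so the bound `|W_l| ≤ N` is not even needed; null components are deleted by `phi_prune`
(`W_∅ = N`), and the hypothesis «all vertices at distance ≤ 1 from `s` lie in `Λ_N`» holds eventually along any
exhaustion (`IsExhaustion.eventually_vertices_mem`). [cite: Chatterjee2019LargeN, Theorem 9.1 and its proof (from Theorem 8.1)] -/
theorem thooftMasterLoopEquation_of_unsymmetrized (hU : UnsymmetrizedMasterLoopEquation d) :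
    THooftMasterLoopEquation d := by
  intro hd Λ hΛ β ν hν φ hφ l rest hs x₀
  set e := l.get x₀ with he
  have hl : IsClosedPath l := (hs l (by simp)).1.1
  have hrest : IsLoopSeq rest := fun w hw => hs w (List.mem_cons_of_mem _ hw)
  -- the evaluations along the subsequence, on minimal representations
  set P : ℕ → LoopSeq d → ℝ := fun k s => phi (ν k) β (Λ (ν k)) (LoopSeq.prune s) with hP
  have hPt : ∀ s : LoopSeq d, IsLoopSeq (LoopSeq.prune s) →
      Tendsto (fun k => P k s) atTop (𝓝 (φ (LoopSeq.prune s))) := fun s h => hφ _ h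
  -- genuineness of everything produced at the marked edge
  have gSplitNeg : ∀ xy ∈ Word.invPairs l e,
      IsLoopSeq (LoopSeq.prune (Word.negSplit₁ l xy.1 xy.2 :: Word.negSplit₂ l xy.1 xy.2 :: rest)) := fun xy hxy =>
    isLoopSeq_prune_of (L := [_, _]) hrest (by
      have h := Word.get_eq_of_mem_invPairs hxy
      intro w hw; simp only [List.mem_cons, List.not_mem_nil, or_false] at hw
      rcases hw with rfl | rfl
      exacts [Word.isLoop_negSplit₁ hl h, Word.isLoop_negSplit₂ hl h])
  have gSplitPos : ∀ xy ∈ Word.samePairs l e,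
      IsLoopSeq (LoopSeq.prune (Word.posSplit₁ l xy.1 xy.2 :: Word.posSplit₂ l xy.1 xy.2 :: rest)) := fun xy hxy =>
    isLoopSeq_prune_of (L := [_, _]) hrest (by
      obtain ⟨hne, h⟩ := Word.get_eq_of_mem_samePairs hxy
      intro w hw; simp only [List.mem_cons, List.not_mem_nil, or_false] at hw
      rcases hw with rfl | rfl
      exacts [Word.isLoop_posSplit₁ hl hne h, Word.isLoop_posSplit₂ hl hne h])
  have gTwistNeg : ∀ xy ∈ Word.samePairs l e, IsLoopSeq (LoopSeq.prune (Word.negTwist l xy.1 xy.2 :: rest)) :=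
    fun xy hxy => isLoopSeq_prune_of (L := [_]) hrest (by
      obtain ⟨hne, h⟩ := Word.get_eq_of_mem_samePairs hxy
      intro w hw; simp only [List.mem_cons, List.not_mem_nil, or_false] at hw
      subst hw; exact Word.isLoop_negTwist hl hne h)
  have gTwistPos : ∀ xy ∈ Word.invPairs l e, IsLoopSeq (LoopSeq.prune (Word.posTwist l xy.1 xy.2 :: rest)) :=
    fun xy hxy => isLoopSeq_prune_of (L := [_]) hrest (by
      have h := Word.get_eq_of_mem_invPairs hxy
      intro w hw; simp only [List.mem_cons, List.not_mem_nil, or_false] at hw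
      subst hw; exact Word.isLoop_posTwist hl h)
  have gDefNeg : ∀ p ∈ plaquettesAt e, ∀ x ∈ Word.locs l e, IsLoopSeq (LoopSeq.prune (Word.negDeform l x p :: rest)) :=
    fun p hp x hx => isLoopSeq_prune_of (L := [_]) hrest (by
      intro w hw; simp only [List.mem_cons, List.not_mem_nil, or_false] at hw
      subst hw
      exact Word.isLoop_negDeform hl x (by rwa [Word.plaquettesAt_eq_of_mem_locs hx]))
  have gDefPos : ∀ p ∈ plaquettesAt e, ∀ x ∈ Word.locs l e, IsLoopSeq (LoopSeq.prune (Word.posDeform l x p :: rest)) :=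
    fun p hp x hx => isLoopSeq_prune_of (L := [_]) hrest (by
      intro w hw; simp only [List.mem_cons, List.not_mem_nil, or_false] at hw
      subst hw
      exact Word.isLoop_posDeform hl x (by rwa [Word.plaquettesAt_eq_of_mem_locs hx]))
  have hrest' : ∀ j : Fin rest.length, IsLoopSeq (rest.eraseIdx j) := fun j w hw =>
    hrest w (List.mem_of_mem_eraseIdx hw)
  have gMergeNeg : ∀ (j : Fin rest.length), ∀ x ∈ Word.locs l e, ∀ y ∈ Word.locs (rest.get j) e,
      IsLoopSeq (LoopSeq.prune (Word.negMerge l x (rest.get j) y :: rest.eraseIdx j)) :=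
    fun j x hx y hy => isLoopSeq_prune_of (L := [_]) (hrest' j) (by
      intro w hw; simp only [List.mem_cons, List.not_mem_nil, or_false] at hw
      subst hw
      exact Word.isLoop_negMerge hl (hrest _ (List.get_mem rest j)).1.1
        (by rw [Word.fst_get_eq_of_mem_locs hy, Word.fst_get_eq_of_mem_locs hx]))
  have gMergePos : ∀ (j : Fin rest.length), ∀ x ∈ Word.locs l e, ∀ y ∈ Word.locs (rest.get j) e,
      IsLoopSeq (LoopSeq.prune (Word.posMerge l x (rest.get j) y :: rest.eraseIdx j)) :=
    fun j x hx y hy => isLoopSeq_prune_of (L := [_]) (hrest' j) (by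
      intro w hw; simp only [List.mem_cons, List.not_mem_nil, or_false] at hw
      subst hw
      exact Word.isLoop_posMerge hl (hrest _ (List.get_mem rest j)).1.1
        (by rw [Word.fst_get_eq_of_mem_locs hy, Word.fst_get_eq_of_mem_locs hx]))
  -- limits of the four terms along the subsequence
  have hT : Tendsto (fun k => twistTermAt (P k) l rest e) atTop
      (𝓝 (twistTermAt (fun s' => φ (LoopSeq.prune s')) l rest e)) :=
    (tendsto_finsetSum _ fun xy hxy => hPt _ (gTwistNeg xy hxy)).sub
      (tendsto_finsetSum _ fun xy hxy => hPt _ (gTwistPos xy hxy))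
  have hS : Tendsto (fun k => splitTermAt (P k) l rest e) atTop
      (𝓝 (splitTermAt (fun s' => φ (LoopSeq.prune s')) l rest e)) :=
    (tendsto_finsetSum _ fun xy hxy => hPt _ (gSplitNeg xy hxy)).sub
      (tendsto_finsetSum _ fun xy hxy => hPt _ (gSplitPos xy hxy))
  have hD : Tendsto (fun k => deformTermAt (P k) l rest e) atTop
      (𝓝 (deformTermAt (fun s' => φ (LoopSeq.prune s')) l rest e)) :=
    (tendsto_finsetSum _ fun p hp => tendsto_finsetSum _ fun x hx => hPt _ (gDefNeg p hp x hx)).sub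
      (tendsto_finsetSum _ fun p hp => tendsto_finsetSum _ fun x hx => hPt _ (gDefPos p hp x hx))
  have hM : Tendsto (fun k => mergeTermAt (P k) l rest e) atTop
      (𝓝 (mergeTermAt (fun s' => φ (LoopSeq.prune s')) l rest e)) :=
    (tendsto_finsetSum _ fun j _ => tendsto_finsetSum _ fun x hx => tendsto_finsetSum _ fun y hy =>
        hPt _ (gMergeNeg j x hx y hy)).sub
      (tendsto_finsetSum _ fun j _ => tendsto_finsetSum _ fun x hx => tendsto_finsetSum _ fun y hy =>
        hPt _ (gMergePos j x hx y hy))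
  -- `1/N → 0` along the subsequence
  have hνtop : Tendsto ν atTop atTop := hν.tendsto_atTop
  have hinv : Tendsto (fun k => (1 : ℝ) / (ν k : ℝ)) atTop (𝓝 0) :=
    tendsto_one_div_atTop_nhds_zero_nat.comp hνtop
  -- the left-hand side: `φ_{ν k}(l :: rest) → φ(l :: rest)`
  have hs' : LoopSeq.prune (l :: rest) = l :: rest := LoopSeq.prune_eq_self fun w hw => (hs w hw).2
  have hL : Tendsto (fun k => P k (l :: rest)) atTop (𝓝 (φ (l :: rest))) := by
    have := hPt (l :: rest) (by rw [hs']; exact hs)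
    rwa [hs'] at this
  -- Step 1: eventually, the finite-`N` equation divided by `N^{n+1}`
  have hev : ∀ᶠ k in atTop,
      (1 - 1 / (ν k : ℝ)) * (Word.occ l e : ℝ) * P k (l :: rest) =
        (1 / (ν k : ℝ)) * twistTermAt (P k) l rest e + splitTermAt (P k) l rest e +
          (1 / (ν k : ℝ)) ^ 2 * mergeTermAt (P k) l rest e + β * deformTermAt (P k) l rest e := by
    filter_upwards [hνtop.eventually (eventually_ge_atTop 2),
      hνtop.eventually (hΛ.eventually_vertices_mem (l :: rest))] with k hk2 hkv
    set N := ν k with hNdef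
    have hN0 : N ≠ 0 := by omega
    have hN : (N : ℝ) ≠ 0 := by exact_mod_cast hN0
    have hEq := hU hd (Λ N) N hk2 β l rest hs hkv x₀
    rw [← he] at hEq
    set F : LoopSeq d → ℝ := fun s' => soExpect N β (Λ N) (wilsonProd N s') with hF
    set r := rest.length with hr
    -- express every `F`-value through `P k`
    have hFP : ∀ s' : LoopSeq d, F s' = P k s' * (N : ℝ) ^ s'.length := fun s' => by
      rw [hF, hP]; simp only
      rw [soExpect_wilsonProd_eq N hN0, phi_prune N hN0]
    have h0 : soExpect N β (Λ N) (wilsonProd N (l :: rest)) = P k (l :: rest) * (N : ℝ) ^ (r + 1) := by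
      have h := hFP (l :: rest)
      rw [List.length_cons] at h
      exact h
    have h1 : twistTermAt F l rest e = (N : ℝ) ^ (r + 1) * twistTermAt (P k) l rest e := by
      rw [← twistTermAt_mul]
      exact twistTermAt_congr (fun xy _ => by rw [hFP, List.length_cons, mul_comm])
        (fun xy _ => by rw [hFP, List.length_cons, mul_comm])
    have h2 : splitTermAt F l rest e = (N : ℝ) ^ (r + 2) * splitTermAt (P k) l rest e := by
      rw [← splitTermAt_mul]
      exact splitTermAt_congr (fun xy _ => by rw [hFP, List.length_cons, List.length_cons, mul_comm])
        (fun xy _ => by rw [hFP, List.length_cons, List.length_cons, mul_comm])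
    have h3 : mergeTermAt F l rest e = (N : ℝ) ^ r * mergeTermAt (P k) l rest e := by
      rw [← mergeTermAt_mul]
      refine mergeTermAt_congr (fun j x _ y _ => ?_) (fun j x _ y _ => ?_) <;>
      · rw [hFP, List.length_cons, List.length_eraseIdx_of_lt j.isLt, mul_comm]
        congr 2
        have := j.isLt; omega
    have h4 : deformTermAt F l rest e = (N : ℝ) ^ (r + 1) * deformTermAt (P k) l rest e := by
      rw [← deformTermAt_mul]
      exact deformTermAt_congr (fun p _ x _ => by rw [hFP, List.length_cons, mul_comm])
        (fun p _ x _ => by rw [hFP, List.length_cons, mul_comm])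
    rw [h0, h1, h2, h3, h4] at hEq
    -- divide by `N^{r+2}`
    have key : ∀ A T S M D : ℝ,
        ((N : ℝ) - 1) * (Word.occ l e : ℝ) * (A * (N : ℝ) ^ (r + 1)) =
          (N : ℝ) ^ (r + 1) * T + (N : ℝ) ^ (r + 2) * S + (N : ℝ) ^ r * M + (N : ℝ) * β * ((N : ℝ) ^ (r + 1) * D) →
        (1 - 1 / (N : ℝ)) * (Word.occ l e : ℝ) * A =
          1 / (N : ℝ) * T + S + (1 / (N : ℝ)) ^ 2 * M + β * D := by
      intro A T S M D h
      have hpow : (N : ℝ) ^ (r + 2) ≠ 0 := pow_ne_zero _ hN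
      have e1 : (1 - 1 / (N : ℝ)) * (Word.occ l e : ℝ) * A =
          ((N : ℝ) - 1) * (Word.occ l e : ℝ) * (A * (N : ℝ) ^ (r + 1)) / (N : ℝ) ^ (r + 2) := by
        field_simp; ring
      have e2 : 1 / (N : ℝ) * T + S + (1 / (N : ℝ)) ^ 2 * M + β * D =
          ((N : ℝ) ^ (r + 1) * T + (N : ℝ) ^ (r + 2) * S + (N : ℝ) ^ r * M + (N : ℝ) * β * ((N : ℝ) ^ (r + 1) * D)) /
            (N : ℝ) ^ (r + 2) := by
        field_simp; ring
      rw [e1, e2, h]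
    exact key _ _ _ _ _ hEq
  -- Step 2: pass to the limit
  have hlhs : Tendsto (fun k => (1 - 1 / (ν k : ℝ)) * (Word.occ l e : ℝ) * P k (l :: rest)) atTop
      (𝓝 ((1 - 0) * (Word.occ l e : ℝ) * φ (l :: rest))) :=
    ((tendsto_const_nhds.sub hinv).mul tendsto_const_nhds).mul hL
  have hrhs : Tendsto (fun k => (1 / (ν k : ℝ)) * twistTermAt (P k) l rest e + splitTermAt (P k) l rest e +
        (1 / (ν k : ℝ)) ^ 2 * mergeTermAt (P k) l rest e + β * deformTermAt (P k) l rest e) atTop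
      (𝓝 (0 * twistTermAt (fun s' => φ (LoopSeq.prune s')) l rest e +
        splitTermAt (fun s' => φ (LoopSeq.prune s')) l rest e +
        0 ^ 2 * mergeTermAt (fun s' => φ (LoopSeq.prune s')) l rest e +
        β * deformTermAt (fun s' => φ (LoopSeq.prune s')) l rest e)) :=
    (((hinv.mul hT).add hS).add ((hinv.pow 2).mul hM)).add (tendsto_const_nhds.mul hD)
  have := tendsto_nhds_unique (hlhs.congr' hev) hrhs
  simp only [sub_zero, one_mul, zero_mul, zero_add, add_zero, ne_eq, OfNat.ofNat_ne_zero, not_false_eq_true,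
    zero_pow] at this
  exact this

end THooftFromFiniteN

end Literature.MathematicalPhysics.QuantumFieldTheory.Chatterjee2019LargeN

end
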